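import Summits.BirchSwinnertonDyer.Rank1Residual.ManinAdditive.ShimuraCoverMuThree
import Summits.BirchSwinnertonDyer.BirchSwinnertonDyer.Theorems.ManinLocalTwoThreeMuThreeSignAtThree
import Summits.BirchSwinnertonDyer.BirchSwinnertonDyer.Theorems.ManinLocalTwoThreeCuspZeroAnnihilatorOfCuspGalois
import Summits.BirchSwinnertonDyer.BirchSwinnertonDyer.Theorems.ManinLocalTwoThreeShimuraIndexMuThree
import Literature.NumberTheory.EllipticCurves.LatticeInclusionIsogenyDegreeProofs
import Mathlib.FieldTheory.Galois.Infinite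
import HarnessLib

/-!
# E-an-234 `ShimuraCoverKernelGivesMuThree` IS A THEOREM (an g41 TURNKEY P-an-g41-1, MEMO-an §86.11; FILE K = `ManinAdditive/ShimuraCoverMuThree.lean`)
Cell bsd-f2-manin, width prover p3 g17.  A constant-kernel Shimura cover with a kernel point of order `3` forces `μ₃ ⊂ W₀`; with an's PROVED
edges: **E-an-225 `ShimuraThreeKernelHasMuThree` ⟸ F★ ∧ CES** (`ShimuraCover.shimuraThreeKernelHasMuThree_of_cover`), E-es-67♮ ⟸ F★ ∧ CES,
E-an-222ₒ ⟸ E-an-223 ∧ {F★₀, F★, F♮, CES}.  PROOF (an's (i)–(v), tree tools only): `ψ : W₁ → W₀` = analytic descent of `z ↦ (c₀/c₁)z`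
(`exists_isogeny_apply_eq_degree_eq_of_forall_mul_mem_lattice`); (i) kernel points lie over `u₁(c₁Λ₀(f))`, are rational (hypothesis), hence
`Γ_ℚ`-fixed; (ii) `W₁[3] ⊄ ker ψ`, else the Weil pairing (`exists_weilPairing_holds`) has a `Γ_ℚ`-fixed primitive cube root of unity as a value,
which would be rational (`InfiniteGalois.mem_range_algebraMap_iff_fixed`); (iii) `ker ψ ∩ W₁[3] = ⟨k⟩`, `M := ψ(W₁[3])` is a stable line;
(iv) `σ ψQ = ±ψQ` gives `σQ ∓ Q ∈ ⟨k⟩`, so `σ` acts on `ζ = e₃(k,Q)` by `ζ^{±1}` and — every `e₃`-value being a power of `ζ` — with the same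
sign on `e₃(ψQ, T)`, whence `e₃(ψQ, σT − T) = 1` and `σT − T ∈ M`; (v) `hasShortMuThree_of_trivialQuotientLine`.  Unconditional tree theorem;
C3 / Manin's conjecture / BSD are NOT proved by this.  [cite: Vatsal2005, Rem. 1.8] [cite: SilvermanAEC2009, Prop. III.8.1, Thm. VI.4.1]
-/

set_option linter.dupNamespace false
set_option autoImplicit false
noncomputable section
open scoped Classical MatrixGroups ModularForm PeriodPair

open CongruenceSubgroup WeierstrassCurve Field Polynomial Literature.NumberTheory.EllipticCurves
  Literature.NumberTheory.EllipticCurves.ModularForms Summit.BirchSwinnertonDyer.Rank1Residual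
  Summit.BirchSwinnertonDyer.Rank1Residual.ManinAdditive Summit.BirchSwinnertonDyer.Rank1Residual.ManinAdditive.KatoCurve
  Summit.BirchSwinnertonDyer.Rank1Residual.ManinAdditive.ShimuraCover
  Summit.BirchSwinnertonDyer.BirchSwinnertonDyer.Theorems.ManinLocalTwoThree.CuspGalois

namespace Summit.BirchSwinnertonDyer.BirchSwinnertonDyer.Theorems.ManinLocalTwoThree.ShimuraCoverHolds

/-! ### §1. Two algebra lemmas -/

/-- A rational cube root of unity is `1`. [folklore] -/
theorem rat_eq_one_of_pow_three_eq_one {q : ℚ} (hq : q ^ 3 = 1) : q = 1 := by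
  have h : (q - 1) * ((q + 1 / 2) ^ 2 + 3 / 4) = 0 := by linear_combination hq
  rcases mul_eq_zero.mp h with h | h
  · linarith
  · nlinarith [sq_nonneg (q + 1 / 2)]

/-- In a field, every cube root of unity is a power of a given primitive one: `w ∈ {1, ζ, ζ²}`. [folklore] -/
theorem eq_pow_of_pow_three_eq_one {F : Type*} [Field F] {ζ w : F} (hζ : ζ ^ 3 = 1) (hζ1 : ζ ≠ 1) (hw : w ^ 3 = 1) :
    w = 1 ∨ w = ζ ∨ w = ζ ^ 2 := by
  have hζ2 : ζ ^ 2 + ζ + 1 = 0 := by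
    have h : (ζ - 1) * (ζ ^ 2 + ζ + 1) = 0 := by linear_combination hζ
    exact (mul_eq_zero.mp h).resolve_left (sub_ne_zero.mpr hζ1)
  have h : (w - 1) * ((w - ζ) * (w - ζ ^ 2)) = 0 := by
    linear_combination hw + (w - w ^ 2) * hζ2 + (w - 1) * hζ
  rcases mul_eq_zero.mp h with h | h
  · exact Or.inl (sub_eq_zero.mp h)
  · rcases mul_eq_zero.mp h with h | h
    · exact Or.inr (Or.inl (sub_eq_zero.mp h))
    · exact Or.inr (Or.inr (sub_eq_zero.mp h))

/-- Elementary consequences of bilinearity/alternation for a `μ_m`-valued pairing on an abelian group. [folklore] -/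
theorem pairing_basics {G F : Type*} [AddCommGroup G] [Field F] {e : G → G → F} {m : ℕ} (hm : m ≠ 0)
    (hpow : ∀ S T, e S T ^ m = 1) (haddl : ∀ S₁ S₂ T, e (S₁ + S₂) T = e S₁ T * e S₂ T)
    (haddr : ∀ S T₁ T₂, e S (T₁ + T₂) = e S T₁ * e S T₂) (hself : ∀ T, e T T = 1) :
    (∀ S T, e S T ≠ 0) ∧ (∀ T, e 0 T = 1) ∧ (∀ S, e S 0 = 1) ∧ (∀ S T, e (-S) T * e S T = 1) ∧
      (∀ S T, e S (-T) * e S T = 1) ∧ (∀ S T, e S T * e T S = 1) := by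
  have hne0 : ∀ S T, e S T ≠ 0 := fun S T h0 ↦ by
    have := hpow S T
    rw [h0, zero_pow hm] at this
    exact zero_ne_one this
  have he0l : ∀ T, e 0 T = 1 := fun T ↦ by
    have h := haddl 0 0 T
    rw [add_zero] at h
    exact (mul_eq_left₀ (hne0 0 T)).mp h.symm
  have he0r : ∀ S, e S 0 = 1 := fun S ↦ by
    have h := haddr S 0 0
    rw [add_zero] at h
    exact (mul_eq_left₀ (hne0 S 0)).mp h.symm
  refine ⟨hne0, he0l, he0r, fun S T ↦ by rw [← haddl, neg_add_cancel, he0l],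
    fun S T ↦ by rw [← haddr, neg_add_cancel, he0r], fun S T ↦ ?_⟩
  have h := hself (S + T)
  rw [haddl, haddr, haddr, hself, hself, one_mul, mul_one] at h
  exact h

/-- In a group of order `p²` (`p` prime), a subgroup containing a non-zero element `a` and different from `⊤` is `⟨a⟩`,
and its elements are `0, a, …`; specialised to `p = 3`: the elements of a proper subgroup through `a ≠ 0` are `0, a, −a`. [folklore] -/
theorem eq_zmultiples_of_card_eq_nine {G : Type*} [AddCommGroup G] (hG : Nat.card G = 3 ^ 2) {K : AddSubgroup G} {a : G}
    (ha : a ∈ K) (ha0 : a ≠ 0) (h3a : (3 : ℕ) • a = 0) (hK : K ≠ ⊤) :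
    K = AddSubgroup.zmultiples a ∧ ∀ S ∈ K, S = 0 ∨ S = a ∨ S = -a := by
  haveI : Finite G := Nat.finite_of_card_ne_zero (by rw [hG]; norm_num)
  haveI : Fact (Nat.Prime 3) := ⟨Nat.prime_three⟩
  have horder : addOrderOf a = 3 := by
    have hdvd : addOrderOf a ∣ 3 := addOrderOf_dvd_of_nsmul_eq_zero h3a
    rcases (Nat.dvd_prime Nat.prime_three).mp hdvd with h1 | h3
    · exact absurd (AddMonoid.addOrderOf_eq_one_iff.mp h1) ha0
    · exact h3
  have hle : AddSubgroup.zmultiples a ≤ K := (AddSubgroup.zmultiples_le).mpr ha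
  have hKeq : K = AddSubgroup.zmultiples a := by
    have hdvd : Nat.card K ∣ Nat.card G := AddSubgroup.card_addSubgroup_dvd_card K
    rw [hG] at hdvd
    obtain ⟨i, hi, hi'⟩ := (Nat.dvd_prime_pow Nat.prime_three).mp hdvd
    have hKbot : K ≠ ⊥ := fun hbot ↦ by
      rw [hbot, AddSubgroup.mem_bot] at ha
      exact ha0 ha
    interval_cases i
    · exact absurd (AddSubgroup.eq_bot_of_card_eq K (by simpa using hi')) hKbot
    · symm
      refine AddSubgroup.eq_of_le_of_card_ge hle ?_
      rw [hi', pow_one, Nat.card_zmultiples, horder]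
    · exact absurd ((AddSubgroup.card_eq_iff_eq_top K).mp (hi'.trans hG.symm)) hK
  refine ⟨hKeq, fun S hS ↦ ?_⟩
  rw [hKeq] at hS
  obtain ⟨n, rfl⟩ := AddSubgroup.mem_zmultiples_iff.mp hS
  obtain ⟨q, r, hnqr, hr⟩ : ∃ q r : ℤ, n = r + q * 3 ∧ (r = 0 ∨ r = 1 ∨ r = 2) := ⟨n / 3, n % 3, by omega, by omega⟩
  have h3a' : (3 : ℤ) • a = 0 := by exact_mod_cast h3a
  have h2a : (2 : ℤ) • a = -a := by
    have : (2 : ℤ) • a + a = (3 : ℤ) • a := by rw [show (3 : ℤ) = 2 + 1 by norm_num, add_zsmul, one_zsmul]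
    rw [h3a'] at this
    exact eq_neg_of_add_eq_zero_left this
  have hn : n • a = r • a := by rw [hnqr, add_zsmul, mul_zsmul, h3a', zsmul_zero, add_zero]
  rw [hn]
  rcases hr with h | h | h
  · left; rw [h, zero_zsmul]
  · right; left; rw [h, one_zsmul]
  · right; right; rw [h, h2a]

/-! ### §2. E-an-234 -/

/-- **E-an-234 `ShimuraCoverKernelGivesMuThree` HOLDS** (an g41 MEMO-an §86.11 steps (i)–(v); unconditional). With an's PROVED edges:
E-an-225 `ShimuraThreeKernelHasMuThree` ⟸ F★ ∧ CES (`ShimuraCover.shimuraThreeKernelHasMuThree_of_cover`).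
[cite: Vatsal2005, Rem. 1.8] [cite: SilvermanAEC2009, Prop. III.8.1 and Thm. VI.4.1] -/
theorem shimuraCoverKernelGivesMuThree_holds : ShimuraCoverKernelGivesMuThree := by
  intro W₀ W₁ _ _ _ _ N _ D₀ D₁ hf hopt hD₁ hrat x P hx h3x hP hP3
  set Kb := AlgebraicClosure ℚ with hKb
  have hc₀ : (D₀.c : ℂ) ≠ 0 := cast_c_ne_zero_of_latticeOptimal D₀ hopt
  have hc₁ : (D₁.c : ℂ) ≠ 0 := gamma1_cast_c_ne_zero_of_isOptimal D₁ hD₁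
  have hc₀Z : D₀.c ≠ 0 := fun h ↦ hc₀ (by rw [h, Int.cast_zero])
  have hc₁Z : D₁.c ≠ 0 := fun h ↦ hc₁ (by rw [h, Int.cast_zero])
  haveI : Algebra.IsAlgebraic ℚ Kb := AlgebraicClosure.isAlgebraic ℚ
  letI : Algebra Kb ℂ := (IsAlgClosed.lift : Kb →ₐ[ℚ] ℂ).toRingHom.toAlgebra
  haveI : IsScalarTower ℚ Kb ℂ := IsScalarTower.of_algebraMap_eq' (Subsingleton.elim _ _)
  set j : Kb →ₐ[ℚ] ℂ := IsScalarTower.toAlgHom ℚ Kb ℂ with hj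
  have hj₁ : Function.Injective (Affine.Point.map (W' := W₁) j) := Affine.Point.map_injective (W' := W₁) j
  have hj₀ : Function.Injective (Affine.Point.map (W' := W₀) j) := Affine.Point.map_injective (W' := W₀) j
  have hu₀0 : ∀ z, D₀.uniformize z = 0 ↔ z ∈ D₀.L.lattice := fun z ↦ by
    rw [← SetLike.mem_coe, ← D₀.ker_uniformize, SetLike.mem_coe, AddMonoidHom.mem_ker]
  set c : ℚ := (D₀.c : ℚ) / (D₁.c : ℚ) with hcdef
  have hcne : c ≠ 0 := div_ne_zero (Int.cast_ne_zero.mpr hc₀Z) (Int.cast_ne_zero.mpr hc₁Z)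
  have hcC : (c : ℂ) * (D₁.c : ℂ) = (D₀.c : ℂ) := by
    rw [hcdef]; push_cast; field_simp
  have hle : ∀ z ∈ D₁.L.lattice, (c : ℂ) * z ∈ D₀.L.lattice := by
    intro z hz
    obtain ⟨w, hw, rfl⟩ := hD₁ z hz
    have hw₀ : w ∈ periodLattice D₀.f := by
      rw [← hf]; exact periodLatticeGamma1_le_periodLattice D₁.f hw
    rw [← mul_assoc, hcC]
    exact D₀.smul_periodLattice_le w hw₀
  obtain ⟨ψ, hψ, -⟩ := exists_isogeny_apply_eq_degree_eq_of_forall_mul_mem_lattice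
    D₁.isNeronLattice.1 D₁.isNeronLattice.2 D₀.isNeronLattice.1 D₀.isNeronLattice.2
    D₁.uniformize D₁.ker_uniformize D₁.uniformize_surjective D₁.uniformize_spec
    D₀.uniformize D₀.ker_uniformize D₀.uniformize_spec j hcne hle
  set ιP : (W₁.baseChange ℚ).toAffine.Point →+ W₁.geomPoints := Affine.Point.baseChange (W' := W₁) ℚ Kb with hιP
  have hιj : ∀ R, Affine.Point.map (W' := W₁) j (ιP R) = Affine.Point.baseChange (W' := W₁) ℚ ℂ R :=
    fun R ↦ Affine.Point.map_baseChange (W' := W₁) j R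
  have hιfix : ∀ (σ : Field.absoluteGaloisGroup ℚ) (R : (W₁.baseChange ℚ).toAffine.Point), σ • ιP R = ιP R := by
    intro σ R
    set τ : Kb ≃ₐ[ℚ] Kb := σ with hτ
    change Affine.Point.map (W' := W₁) (τ : Kb →ₐ[ℚ] Kb) (Affine.Point.baseChange (W' := W₁) ℚ Kb R) = _
    exact Affine.Point.map_baseChange (W' := W₁) (τ : Kb →ₐ[ℚ] Kb) R
  have hz₀ : Affine.Point.map (W' := W₀) j (0 : W₀.geomPoints) = 0 := map_zero _
  have hz₁ : Affine.Point.map (W' := W₁) j (0 : W₁.geomPoints) = 0 := map_zero _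
  have hψker : ∀ (m : W₁.geomPoints) (y : ℂ), y ∈ periodLattice D₀.f →
      Affine.Point.map (W' := W₁) j m = D₁.uniformize ((D₁.c : ℂ) * y) → ψ m = 0 := by
    intro m y hy hm
    apply hj₀
    rw [hψ m _ hm, hz₀, hu₀0, ← mul_assoc, hcC]
    exact D₀.smul_periodLattice_le y hy
  have hkerfix : ∀ m : W₁.geomPoints, ψ m = 0 → ∀ σ : Field.absoluteGaloisGroup ℚ, σ • m = m := by
    intro m hm σ
    obtain ⟨z, hz⟩ := D₁.uniformize_surjective (Affine.Point.map (W' := W₁) j m)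
    have h1 := hψ m z hz.symm
    rw [hm, hz₀] at h1
    have hcz : (c : ℂ) * z ∈ D₀.L.lattice := (hu₀0 _).mp h1.symm
    obtain ⟨w, hw, hcw⟩ := hopt _ hcz
    have hz' : z = (D₁.c : ℂ) * w := by
      have h2 : (c : ℂ) * z = (c : ℂ) * ((D₁.c : ℂ) * w) := by rw [hcw, ← mul_assoc, hcC]
      exact mul_left_cancel₀ (by exact_mod_cast hcne) h2
    obtain ⟨R, hR⟩ := hrat w hw
    have hmR : m = ιP R := hj₁ (by rw [hιj, hR, ← hz', hz])
    rw [hmR]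
    exact hιfix σ R
  set k : W₁.geomPoints := ιP P with hk
  have hkj : Affine.Point.map (W' := W₁) j k = D₁.uniformize ((D₁.c : ℂ) * x) := by rw [hk, hιj, hP]
  have hψk : ψ k = 0 := hψker k x hx hkj
  have hk3 : (3 : ℕ) • k = 0 := by
    rw [hk, ← map_nsmul, ← hP3, addOrderOf_nsmul_eq_zero, map_zero]
  have hk0 : k ≠ 0 := by
    intro h0
    have hP0 : P = 0 := (map_eq_zero_iff ιP (Affine.Point.map_injective (W' := W₁) _)).mp h0
    rw [hP0, addOrderOf_zero] at hP3
    exact absurd hP3 (by norm_num)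
  haveI : Fact (Nat.Prime 3) := ⟨Nat.prime_three⟩
  have hsm : ∀ (σ : Field.absoluteGaloisGroup ℚ) (z : Kb), σ • z = (show Kb ≃ₐ[ℚ] Kb from σ) z := fun _ _ ↦ rfl
  have hcard₁ : Nat.card (W₁.geomTorsion 3) = 3 ^ 2 := natCard_geomTorsion W₁ 3
  have hcard₀ : Nat.card (W₀.geomTorsion 3) = 3 ^ 2 := natCard_geomTorsion W₀ 3
  haveI : Finite (W₁.geomTorsion 3) := Nat.finite_of_card_ne_zero (by rw [hcard₁]; norm_num)
  haveI : Finite (W₀.geomTorsion 3) := Nat.finite_of_card_ne_zero (by rw [hcard₀]; norm_num)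
  have hkmem : k ∈ W₁.geomTorsion 3 := AddSubgroup.torsionBy.nsmul_iff.mpr hk3
  set k₃ : W₁.geomTorsion 3 := ⟨k, hkmem⟩ with hk₃
  have hk₃0 : k₃ ≠ 0 := fun h ↦ hk0 (congrArg Subtype.val h)
  have h3k₃ : (3 : ℕ) • k₃ = 0 := Subtype.ext (by simp [hk₃, hk3])
  have hσk₃ : ∀ σ : Field.absoluteGaloisGroup ℚ, σ • k₃ = k₃ := fun σ ↦
    Subtype.ext (by rw [AddSubgroup.torsionBy.coe_smul]; exact hkerfix k hψk σ)
  have hψtors : ∀ T : W₁.geomTorsion 3, ψ (T : W₁.geomPoints) ∈ W₀.geomTorsion 3 := fun T ↦ by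
    apply AddSubgroup.torsionBy.nsmul_iff.mpr
    have hT : (3 : ℕ) • (T : W₁.geomPoints) = 0 := congrArg Subtype.val (AddSubgroup.torsionBy.nsmul T)
    rw [← map_nsmul, hT, map_zero]
  let ψ₃ : W₁.geomTorsion 3 →+ W₀.geomTorsion 3 :=
    { toFun := fun T ↦ ⟨ψ (T : W₁.geomPoints), hψtors T⟩
      map_zero' := Subtype.ext (by simp)
      map_add' := fun a b ↦ Subtype.ext (by simp) }
  have hψ₃ : ∀ T, ((ψ₃ T : W₀.geomTorsion 3) : W₀.geomPoints) = ψ (T : W₁.geomPoints) := fun T ↦ rfl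
  have hψ₃smul : ∀ (σ : Field.absoluteGaloisGroup ℚ) (T : W₁.geomTorsion 3), ψ₃ (σ • T) = σ • ψ₃ T := fun σ T ↦
    Subtype.ext (by rw [hψ₃, AddSubgroup.torsionBy.coe_smul, ψ.map_smul, AddSubgroup.torsionBy.coe_smul, hψ₃])
  have hψ₃k : ψ₃ k₃ = 0 := Subtype.ext (by rw [hψ₃]; exact hψk)
  have hKfix : ∀ T : W₁.geomTorsion 3, ψ₃ T = 0 → ∀ σ : Field.absoluteGaloisGroup ℚ, σ • T = T := fun T hT σ ↦
    Subtype.ext (by rw [AddSubgroup.torsionBy.coe_smul]; exact hkerfix _ (by rw [← hψ₃, hT]; rfl) σ)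
  obtain ⟨e₁, hpow₁, haddl₁, haddr₁, hself₁, hnondeg₁, hgal₁⟩ := W₁.exists_weilPairing_holds 3 (by norm_num) (by norm_num)
  obtain ⟨e₀, hpow₀, haddl₀, haddr₀, hself₀, hnondeg₀, hgal₀⟩ := W₀.exists_weilPairing_holds 3 (by norm_num) (by norm_num)
  obtain ⟨hne₁, he0l₁, he0r₁, hnegl₁, hnegr₁, hanti₁⟩ := pairing_basics (by norm_num) hpow₁ haddl₁ haddr₁ hself₁
  obtain ⟨hne₀, he0l₀, he0r₀, hnegl₀, hnegr₀, hanti₀⟩ := pairing_basics (by norm_num) hpow₀ haddl₀ haddr₀ hself₀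
  haveI : IsGalois ℚ Kb := @IsAlgClosure.isGalois ℚ Kb _ _ (AlgebraicClosure.instAlgebra ℚ) _ _
  have hKtop : ψ₃.ker ≠ ⊤ := by
    intro htop
    have hfix : ∀ (σ : Field.absoluteGaloisGroup ℚ) (T : W₁.geomTorsion 3), σ • T = T := fun σ T ↦
      hKfix T (by rw [← AddMonoidHom.mem_ker, htop]; exact AddSubgroup.mem_top T) σ
    obtain ⟨S, T, hST⟩ : ∃ S T, e₁ S T ≠ 1 := by
      by_contra hall
      push Not at hall
      have hall0 : ∀ T : W₁.geomTorsion 3, T = 0 := fun T ↦ hnondeg₁ T fun S ↦ hall S T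
      have : Nat.card (W₁.geomTorsion 3) = 1 := by
        rw [Nat.card_eq_one_iff_exists]
        exact ⟨0, fun T ↦ hall0 T⟩
      rw [hcard₁] at this
      norm_num at this
    set ζ := e₁ S T with hζ
    have hζfix : ∀ f : Kb ≃ₐ[ℚ] Kb, f ζ = ζ := fun f ↦ by
      have h := hgal₁ f S T
      rw [hfix, hfix, ← hζ] at h
      exact h
    obtain ⟨q, hq⟩ := (InfiniteGalois.mem_range_algebraMap_iff_fixed ζ).mpr hζfix
    have hq3 : q ^ 3 = 1 := by
      have h := hpow₁ S T
      rw [← hζ, ← hq, ← map_pow] at h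
      exact_mod_cast (algebraMap ℚ Kb).injective (by rw [h, map_one])
    have hq1 := rat_eq_one_of_pow_three_eq_one hq3
    rw [hq1, map_one] at hq
    exact hST hq.symm
  obtain ⟨hKeq, hKel⟩ := eq_zmultiples_of_card_eq_nine hcard₁ (AddMonoidHom.mem_ker.mpr hψ₃k) hk₃0 h3k₃ hKtop
  obtain ⟨Q, hQ⟩ : ∃ Q : W₁.geomTorsion 3, Q ∉ ψ₃.ker := by
    by_contra hall
    push Not at hall
    exact hKtop ((AddSubgroup.eq_top_iff' _).mpr hall)
  set m₀ : W₀.geomTorsion 3 := ψ₃ Q with hm₀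
  have hm₀0 : m₀ ≠ 0 := fun h ↦ hQ (AddMonoidHom.mem_ker.mpr h)
  have h3m₀ : (3 : ℕ) • m₀ = 0 := by rw [hm₀, ← map_nsmul, AddSubgroup.torsionBy.nsmul, map_zero]
  set M : AddSubgroup (W₀.geomTorsion 3) := ψ₃.range with hM
  have hm₀M : m₀ ∈ M := ⟨Q, rfl⟩
  have hMcard : Nat.card M = 3 := by
    have h1 : ψ₃.ker.index = Nat.card M := AddSubgroup.index_ker ψ₃
    have h2 : ψ₃.ker.index * Nat.card ψ₃.ker = Nat.card (W₁.geomTorsion 3) := AddSubgroup.index_mul_card ψ₃.ker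
    have h3 : Nat.card ψ₃.ker = 3 := by
      rw [hKeq, Nat.card_zmultiples, addOrderOf_eq_of_ne_zero W₁ 3 hk₃0]
    rw [h1, h3, hcard₁] at h2
    omega
  have hMtop : M ≠ ⊤ := fun htop ↦ by
    have := (AddSubgroup.card_eq_iff_eq_top M).mpr htop
    rw [hMcard, hcard₀] at this
    norm_num at this
  obtain ⟨hMeq, hMel⟩ := eq_zmultiples_of_card_eq_nine hcard₀ hm₀M hm₀0 h3m₀ hMtop
  have hMst : ∀ σ : Field.absoluteGaloisGroup ℚ, ∀ a ∈ M, σ • a ∈ M := by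
    rintro σ a ⟨T, rfl⟩
    exact ⟨σ • T, hψ₃smul σ T⟩
  have hann : ∀ X : W₀.geomTorsion 3, e₀ m₀ X = 1 → X ∈ M := by
    let K₀ : AddSubgroup (W₀.geomTorsion 3) :=
      { carrier := {X | e₀ m₀ X = 1}
        add_mem' := fun {a b} ha hb ↦ by
          simp only [Set.mem_setOf_eq] at ha hb ⊢
          rw [haddr₀, ha, hb, one_mul]
        zero_mem' := by simp only [Set.mem_setOf_eq]; exact he0r₀ m₀
        neg_mem' := fun {a} ha ↦ by
          simp only [Set.mem_setOf_eq] at ha ⊢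
          have h := hnegr₀ m₀ a
          rwa [ha, mul_one] at h }
    have hK₀top : K₀ ≠ ⊤ := by
      intro htop
      apply hm₀0
      refine hnondeg₀ m₀ fun S ↦ ?_
      have hS : e₀ m₀ S = 1 := by
        have : S ∈ K₀ := htop ▸ AddSubgroup.mem_top S
        exact this
      have h := hanti₀ m₀ S
      rwa [hS, one_mul] at h
    obtain ⟨hK₀eq, -⟩ := eq_zmultiples_of_card_eq_nine hcard₀ (show m₀ ∈ K₀ from hself₀ m₀) hm₀0 h3m₀ hK₀top
    intro X hX
    have : X ∈ K₀ := hX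
    rw [hK₀eq] at this
    rwa [hMeq]
  set ζ := e₁ k₃ Q with hζdef
  have hζ3 : ζ ^ 3 = 1 := hpow₁ k₃ Q
  have hζ1 : ζ ≠ 1 := by
    intro h1
    let K₁ : AddSubgroup (W₁.geomTorsion 3) :=
      { carrier := {X | e₁ k₃ X = 1}
        add_mem' := fun {a b} ha hb ↦ by
          simp only [Set.mem_setOf_eq] at ha hb ⊢
          rw [haddr₁, ha, hb, one_mul]
        zero_mem' := by simp only [Set.mem_setOf_eq]; exact he0r₁ k₃
        neg_mem' := fun {a} ha ↦ by
          simp only [Set.mem_setOf_eq] at ha ⊢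
          have h := hnegr₁ k₃ a
          rwa [ha, mul_one] at h }
    have hK₁top : K₁ ≠ ⊤ := by
      intro htop
      apply hk₃0
      refine hnondeg₁ k₃ fun S ↦ ?_
      have hS : e₁ k₃ S = 1 := by
        have : S ∈ K₁ := htop ▸ AddSubgroup.mem_top S
        exact this
      have h := hanti₁ k₃ S
      rwa [hS, one_mul] at h
    obtain ⟨hK₁eq, -⟩ := eq_zmultiples_of_card_eq_nine hcard₁ (show k₃ ∈ K₁ from hself₁ k₃) hk₃0 h3k₃ hK₁top
    have hQK : Q ∈ K₁ := h1
    rw [hK₁eq, ← hKeq] at hQK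
    exact hQ hQK
  have hek : ∀ S ∈ ψ₃.ker, e₁ k₃ S = 1 := by
    intro S hS
    rcases hKel S hS with h | h | h <;> rw [h]
    · exact he0r₁ k₃
    · exact hself₁ k₃
    · have h' := hnegr₁ k₃ k₃
      rwa [hself₁, mul_one] at h'
  have htriv : ∀ (σ : Field.absoluteGaloisGroup ℚ) (T₀ : W₀.geomTorsion 3), σ • T₀ - T₀ ∈ M := by
    intro σ T₀
    set τ : Kb ≃ₐ[ℚ] Kb := σ with hτ
    have hσm₀M : σ • m₀ ∈ M := hMst σ m₀ hm₀M
    have hσm₀0 : σ • m₀ ≠ 0 := fun h ↦ hm₀0 (by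
      have := congrArg (fun y ↦ σ⁻¹ • y) h
      simpa using this)
    set w₀ := e₀ m₀ T₀ with hw₀
    have hw₀3 : w₀ ^ 3 = 1 := hpow₀ m₀ T₀
    have hkey : e₀ m₀ (σ • T₀) = w₀ := by
      rcases hMel _ hσm₀M with h0 | hp | hn
      · exact absurd h0 hσm₀0
      · -- `σ m₀ = m₀`: then `σQ − Q ∈ ker ψ₃`, `σζ = ζ`, `σ w₀ = w₀`
        have hσQ : σ • Q - Q ∈ ψ₃.ker := by
          rw [AddMonoidHom.mem_ker, map_sub, hψ₃smul, ← hm₀, hp, sub_self]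
        have hσζ : τ ζ = ζ := by
          have h := hgal₁ σ k₃ Q
          rw [hσk₃, hsm] at h
          rw [h, show σ • Q = (σ • Q - Q) + Q by abel, haddr₁, hek _ hσQ, one_mul]
        have hσw : τ w₀ = w₀ := by
          rcases eq_pow_of_pow_three_eq_one hζ3 hζ1 hw₀3 with h | h | h <;> rw [h]
          · exact map_one τ
          · exact hσζ
          · rw [map_pow, hσζ]
        have h := hgal₀ σ m₀ T₀
        rw [hp, hsm, ← hw₀, hσw] at h
        exact h.symm
      · -- `σ m₀ = −m₀`: then `σQ + Q ∈ ker ψ₃`, `σζ = ζ⁻¹`, `σ w₀ = w₀⁻¹`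
        have hσQ : σ • Q + Q ∈ ψ₃.ker := by
          rw [AddMonoidHom.mem_ker, map_add, hψ₃smul, ← hm₀, hn, neg_add_cancel]
        have hσζ : τ ζ * ζ = 1 := by
          have h := hgal₁ σ k₃ Q
          rw [hσk₃, hsm] at h
          rw [h, show σ • Q = (σ • Q + Q) + -Q by abel, haddr₁, hek _ hσQ, one_mul]
          exact hnegr₁ k₃ Q
        have hσw : τ w₀ * w₀ = 1 := by
          rcases eq_pow_of_pow_three_eq_one hζ3 hζ1 hw₀3 with h | h | h <;> rw [h]
          · rw [map_one, one_mul]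
          · exact hσζ
          · rw [map_pow]
            calc τ ζ ^ 2 * ζ ^ 2 = (τ ζ * ζ) ^ 2 := by ring
              _ = 1 := by rw [hσζ, one_pow]
        have h := hgal₀ σ m₀ T₀
        rw [hn, hsm, ← hw₀] at h
        have h1 := hnegl₀ m₀ (σ • T₀)
        rw [← h] at h1
        have hτw0 : τ w₀ ≠ 0 := by
          intro h0
          rw [h0, zero_mul] at hσw
          exact zero_ne_one hσw
        exact mul_left_cancel₀ hτw0 (h1.trans hσw.symm)
    apply hann
    rw [sub_eq_add_neg, haddr₀, hkey, mul_comm]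
    exact hnegr₀ m₀ T₀
  exact hasShortMuThree_of_trivialQuotientLine W₀ hc₀Z hMcard hMst htriv

end Summit.BirchSwinnertonDyer.BirchSwinnertonDyer.Theorems.ManinLocalTwoThree.ShimuraCoverHolds

end
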